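/- Free-seat work of WIDTH SEAT 2/3 `ym-line-cbag-p1-w2` (prover-ym-line-cbag-p1-w2-g16-0; own items stmt-QuantumFields-22254 /
22893 closed), route `EguchiKawaiDirectionLadder` (ideator ym-idea-2, LINE 8): the Assembly item (stmt-QuantumFields-27726). -/
import Summits.QuantumFields.YangMills.Theses.EguchiKawaiDirectionLadder

/-!
# Route `EguchiKawaiDirectionLadder`, Assembly (stmt-QuantumFields-27726):
`TripleSmallBallMargin → DirectionIncrement → EguchiKawaiBreakdown` — PROVED

The route's glue, landed as its ASSEMBLY item (the planner's `Sketch.lean` argument `closes_sketch`, transcribed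
against the route decls).  Write `SB d δ e C` for the tree's `N`-uniform centre-symmetric small-ball hypothesis
`Literature.Barriers.QuantumFields.EKSymSmallBallBound d δ e C`
(`Haar^{⊗d}(Sym_δ ∩ {S_R ≤ t}) ≤ exp(N²(e log t + C))` for `N ≥ N₀`, `t > 0`).  Then:

1. `SB` is MONOTONE in the symmetric-region width: `δ ≤ δ'` and `SB d δ' e C` give `SB d δ e C`
   (`Sym_δ ⊆ Sym_δ'`, `measure_mono`) — `ekSymSmallBallBound_mono_delta`;
2. from `TripleSmallBallMargin` (= `SB 3 δ₀ e₃ C₃` with some `δ₀ > 0`, `e₃ > 3/4`) at any width `0 < δ ≤ δ₀`, `δ < 1/2`,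
   and `DirectionIncrement`, induction on `n` gives `SB (3 + n) δ (e₃ + n·(1 − 2δ)/4) Cₙ` —
   `ekSymSmallBallBound_iterate`;
3. with `δ(d) = min(δ₀, 1/4, (e₃ − 3/4)/d)` the final exponent beats the collapsed one,
   `e₃ + (d − 3)(1 − 2δ)/4 − d/4 = (e₃ − 3/4) − (d − 3)δ/2 > 0`, so the tree's proved reduction
   `Literature.Barriers.QuantumFields.EguchiKawaiBreakdown_of_smallBall` yields the barrier fact.

HONEST FRAMING.  This proves only the implication (the route's `Assembly` item, difficulty S); the two small-ball
bounds `TripleSmallBallMargin` (K_A, XL) and `DirectionIncrement` (K_B, L) are the route's OPEN cruxes, and the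
conclusion is the BARRIER-ledger named fact `EguchiKawaiBreakdown` (centre-symmetry breaking of the naive single-site
Eguchi–Kawai model at weak coupling, every `d ≥ 3`), not the sub-problem Statement.  Nothing here bears on the
Yang–Mills mass gap (Clay), the continuum limit, or large-`N` reduction as a technique; none of that is proved by
anything in this file.
-/

set_option autoImplicit false

noncomputable section

open MeasureTheory
open Literature.Barriers.QuantumFields

namespace Summit.QuantumFields.YangMills.Theorems.EguchiKawaiDirectionLadder

/-- Monotonicity of the small-ball hypothesis in the width of the centre-symmetric region: for `δ ≤ δ'`,
`EKSymSmallBallBound d δ' e C → EKSymSmallBallBound d δ e C` (the region `Sym_δ` only shrinks). -/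
theorem ekSymSmallBallBound_mono_delta {d : ℕ} {δ δ' e C : ℝ} (hle : δ ≤ δ')
    (h : EKSymSmallBallBound d δ' e C) : EKSymSmallBallBound d δ e C := by
  obtain ⟨N₀, hN⟩ := h
  refine ⟨N₀, fun N hN' t ht => le_trans (measure_mono ?_) (hN N hN' t ht)⟩
  refine Set.inter_subset_inter_left _ ?_
  intro U hU μ
  exact (hU μ).trans hle

/-- Iterating the one-direction increment from `d = 3`: under `DirectionIncrement`, a `d = 3` bound with exponent
`e₃` at a width `0 < δ < 1/2` gives, for every `n`, a `d = 3 + n` bound with exponent `e₃ + n·(1 − 2δ)/4` at the same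
width (for some constant). -/
theorem ekSymSmallBallBound_iterate
    (hB : Summit.QuantumFields.YangMills.Theses.EguchiKawaiDirectionLadder.DirectionIncrement)
    {δ e₃ C₃ : ℝ} (hδ : 0 < δ) (hδ' : δ < 1 / 2) (h3 : EKSymSmallBallBound 3 δ e₃ C₃) (n : ℕ) :
    ∃ C : ℝ, EKSymSmallBallBound (3 + n) δ (e₃ + (n : ℝ) * ((1 - 2 * δ) / 4)) C := by
  induction n with
  | zero => exact ⟨C₃, by simpa using h3⟩
  | succ n ih =>
    obtain ⟨C, hC⟩ := ih
    obtain ⟨C', hC'⟩ := hB (3 + n) (by omega) δ _ C hδ hδ' hC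
    refine ⟨C', ?_⟩
    have h1 : 3 + (n + 1) = 3 + n + 1 := by omega
    have h2 : e₃ + ((n + 1 : ℕ) : ℝ) * ((1 - 2 * δ) / 4)
        = e₃ + (n : ℝ) * ((1 - 2 * δ) / 4) + (1 - 2 * δ) / 4 := by
      push_cast; ring
    rw [h1, h2]
    exact hC'

/-- The two cruxes give, for every `d ≥ 3`, a centre-symmetric small-ball bound with SOME exponent above the collapsed
one `d/4` (width `δ(d) = min(δ₀, 1/4, (e₃ − 3/4)/d)`, exponent `e₃ + (d − 3)(1 − 2δ)/4 > d/4`). -/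
theorem exists_ekSymSmallBallBound_gt_quarter
    (hA : Summit.QuantumFields.YangMills.Theses.EguchiKawaiDirectionLadder.TripleSmallBallMargin)
    (hB : Summit.QuantumFields.YangMills.Theses.EguchiKawaiDirectionLadder.DirectionIncrement)
    (d : ℕ) (hd : 3 ≤ d) :
    ∃ δ e C : ℝ, 0 < δ ∧ (d : ℝ) / 4 < e ∧ EKSymSmallBallBound d δ e C := by
  obtain ⟨δ₀, e₃, C₃, hδ₀, he₃, h3⟩ := hA
  have hgpos : 0 < e₃ - 3 / 4 := by linarith
  have hdpos : (0 : ℝ) < d := by exact_mod_cast (show 0 < d by omega)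
  -- the symmetric-region width used at dimension d
  obtain ⟨δ, hδpos, hδle₀, hδle4, hδleg⟩ : ∃ δ : ℝ, 0 < δ ∧ δ ≤ δ₀ ∧ δ ≤ 1 / 4 ∧
      δ ≤ (e₃ - 3 / 4) / d :=
    ⟨min (min δ₀ (1 / 4)) ((e₃ - 3 / 4) / d),
      lt_min (lt_min hδ₀ (by norm_num)) (div_pos hgpos hdpos),
      le_trans (min_le_left _ _) (min_le_left _ _),
      le_trans (min_le_left _ _) (min_le_right _ _),
      min_le_right _ _⟩
  have hδhalf : δ < 1 / 2 := by linarith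
  have h3' : EKSymSmallBallBound 3 δ e₃ C₃ := ekSymSmallBallBound_mono_delta hδle₀ h3
  obtain ⟨C, hC⟩ := ekSymSmallBallBound_iterate hB hδpos hδhalf h3' (d - 3)
  have hd3 : 3 + (d - 3) = d := by omega
  rw [hd3] at hC
  refine ⟨δ, e₃ + ((d - 3 : ℕ) : ℝ) * ((1 - 2 * δ) / 4), C, hδpos, ?_, hC⟩
  have hcast : ((d - 3 : ℕ) : ℝ) = (d : ℝ) - 3 := by
    rw [Nat.cast_sub hd]; norm_num
  rw [hcast]
  have hδd : δ * d ≤ e₃ - 3 / 4 := by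
    have h := hδleg
    rwa [le_div_iff₀ hdpos] at h
  nlinarith [hδd, hδpos, hgpos, hdpos]

/-- The route's deciding implication with the two cruxes as hypotheses: `TripleSmallBallMargin` and
`DirectionIncrement` give the barrier fact `EguchiKawaiBreakdown`, through the tree's proved reduction
`EguchiKawaiBreakdown_of_smallBall`.  (Same text as the planner's `closes_sketch`.) -/
theorem eguchiKawaiBreakdown_of_cruxes
    (hA : Summit.QuantumFields.YangMills.Theses.EguchiKawaiDirectionLadder.TripleSmallBallMargin)
    (hB : Summit.QuantumFields.YangMills.Theses.EguchiKawaiDirectionLadder.DirectionIncrement) :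
    EguchiKawaiBreakdown :=
  EguchiKawaiBreakdown_of_smallBall fun d hd => exists_ekSymSmallBallBound_gt_quarter hA hB d hd

/-- **Assembly item stmt-QuantumFields-27726 of route `EguchiKawaiDirectionLadder` (PROVED):**
`TripleSmallBallMargin → DirectionIncrement → EguchiKawaiBreakdown`.  The conclusion is the barrier-ledger named
fact, NOT the Yang–Mills sub-problem statement; no mass gap is proved here. -/
theorem assembly_proof : Summit.QuantumFields.YangMills.Theses.EguchiKawaiDirectionLadder.Assembly := by
  unfold Summit.QuantumFields.YangMills.Theses.EguchiKawaiDirectionLadder.Assembly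
  exact eguchiKawaiBreakdown_of_cruxes

end Summit.QuantumFields.YangMills.Theorems.EguchiKawaiDirectionLadder

end
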